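import Mathlib
import HarnessLib

/-!
# ValiantsHypothesis / SymPencil — crux `EquivariantSdcNotQP` (stmt-ValiantsHypothesis-17792),
# line `birth_EquivariantSdcNotQP`, stub `stub_permify`, piece (ii′) FINITE CONJUGATION LIFT:
# block-triangular linear algebra (helper file 1/4)

Generic linear algebra used by the proof of (ii′) `FiniteConjugationLift` (the hypothesis `h₂`
of `permify_of_finiteLift_of_permEmbedding`, `…PermifyReduction.lean`):

* `toSquareBlock_mul_of_blockTriangular` — diagonal blocks of a product of block-triangular matrices
  are the products of the diagonal blocks;
* `mulVec_apply_eq_of_blockTriangular`, `mulVec_apply_eq_zero_of_blockTriangular` — rows of `M *ᵥ w`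
  inside / above the top block of the support of `w`;
* `eq_zero_of_blockTriangular_mulVec` — back substitution: if the diagonal blocks meeting the
  support of `w` above level `k₁` are nonsingular and `M *ᵥ w` vanishes there, `w` vanishes above
  level `k₁`;
* `exists_mulVec_eq_zero_of_blockTriangular` — a singular bottom block yields a kernel vector
  supported in the bottom block;
* `exists_adapted_basis` — a basis of a finite-dimensional space adapted to a three-step chain of
  subspaces `S₀ ≤ S₁ ≤ S₂` (labels `0,1,2,3`), with membership read off from coordinates;
* `blockTriangular_toMatrix_of_adapted` — an endomorphism preserving the chain has a
  block-triangular matrix in an adapted basis.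

All statements are folklore; no definitions, no named facts.
-/

noncomputable section

set_option linter.dupNamespace false

namespace Summit.ValiantsHypothesis.ValiantsHypothesis.Theorems.SymPencilEquivariantSdcNotQP.FiniteLift

open Matrix Module Submodule

/-! ### Diagonal blocks of block-triangular matrices -/

section Blocks

variable {R : Type*} {ι : Type*} [Fintype ι] {α : Type*} [LinearOrder α] {b : ι → α}

/-- Diagonal blocks multiply: for block-triangular `M`, `N` (same block structure) the `k`-th
diagonal block of `M * N` is the product of the `k`-th diagonal blocks. [folklore] -/
theorem toSquareBlock_mul_of_blockTriangular [NonUnitalNonAssocSemiring R] {M N : Matrix ι ι R}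
    (hM : M.BlockTriangular b) (hN : N.BlockTriangular b) (k : α) :
    (M * N).toSquareBlock b k = M.toSquareBlock b k * N.toSquareBlock b k := by
  ext ⟨i, hi⟩ ⟨j, hj⟩
  simp only [Matrix.toSquareBlock_def, Matrix.of_apply, Matrix.mul_apply]
  rw [← Fintype.sum_subtype_add_sum_subtype (fun l => b l = k) (fun l => M i l * N l j)]
  conv_rhs => rw [← add_zero (∑ l : {l // b l = k}, M i l * N l j)]
  congr 1
  refine Finset.sum_eq_zero fun l _ => ?_
  rcases lt_or_gt_of_ne l.2 with h | h
  · rw [hM (show b (l : ι) < b i from hi.symm ▸ h), zero_mul]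
  · rw [hN (show b j < b (l : ι) from hj.symm ▸ h), mul_zero]

/-- A row of `M *ᵥ w` in block `k`, when `w` vanishes above level `k`, only sees the diagonal
block `k`. [folklore] -/
theorem mulVec_apply_eq_of_blockTriangular [NonUnitalNonAssocSemiring R] {M : Matrix ι ι R}
    (hM : M.BlockTriangular b) {k : α} {w : ι → R} (hw : ∀ j, k < b j → w j = 0)
    (a : ι) (ha : b a = k) :
    (M *ᵥ w) a = (M.toSquareBlock b k *ᵥ fun j => w j) ⟨a, ha⟩ := by
  simp only [Matrix.mulVec, dotProduct, Matrix.toSquareBlock_def, Matrix.of_apply]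
  rw [← Fintype.sum_subtype_add_sum_subtype (fun l => b l = k) (fun l => M a l * w l)]
  conv_rhs => rw [← add_zero (∑ l : {l // b l = k}, M a l * w l)]
  congr 1
  refine Finset.sum_eq_zero fun l _ => ?_
  rcases lt_or_gt_of_ne l.2 with h | h
  · rw [hM (show b (l : ι) < b a from ha.symm ▸ h), zero_mul]
  · rw [hw l h, mul_zero]

/-- A row of `M *ᵥ w` strictly above the support levels of `w` vanishes. [folklore] -/
theorem mulVec_apply_eq_zero_of_blockTriangular [NonUnitalNonAssocSemiring R] {M : Matrix ι ι R}
    (hM : M.BlockTriangular b) {k : α} {w : ι → R} (hw : ∀ j, k < b j → w j = 0)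
    (a : ι) (ha : k < b a) : (M *ᵥ w) a = 0 := by
  simp only [Matrix.mulVec, dotProduct]
  refine Finset.sum_eq_zero fun l _ => ?_
  rcases le_or_gt (b l) k with h | h
  · rw [hM (lt_of_le_of_lt h ha), zero_mul]
  · rw [hw l h, mul_zero]

/-- Back substitution for block-triangular systems: if for every level `k ≥ k₁` carrying a
non-zero entry of `w` the diagonal block is nonsingular and `M *ᵥ w` vanishes on that block,
then `w` vanishes at all levels `≥ k₁`. [folklore] -/
theorem eq_zero_of_blockTriangular_mulVec {K : Type*} [Field K] [DecidableEq ι]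
    {M : Matrix ι ι K} (hM : M.BlockTriangular b) (w : ι → K) (k₁ : α)
    (h : ∀ k, k₁ ≤ k → (∃ a, b a = k ∧ w a ≠ 0) →
      (M.toSquareBlock b k).det ≠ 0 ∧ ∀ a, b a = k → (M *ᵥ w) a = 0) :
    ∀ a, k₁ ≤ b a → w a = 0 := by
  classical
  by_contra hcon
  push Not at hcon
  set s : Finset ι := Finset.univ.filter fun a => k₁ ≤ b a ∧ w a ≠ 0 with hs
  have hsne : s.Nonempty := by
    obtain ⟨a, ha, hwa⟩ := hcon
    exact ⟨a, by simp [hs, ha, hwa]⟩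
  obtain ⟨a₀, ha₀s, hmax⟩ := Finset.exists_max_image s b hsne
  have ha₀ : k₁ ≤ b a₀ ∧ w a₀ ≠ 0 := by simpa [hs] using ha₀s
  -- `w` vanishes strictly above the level of `a₀`
  have habove : ∀ j, b a₀ < b j → w j = 0 := by
    intro j hj
    by_contra hwj
    have hjs : j ∈ s := by simp [hs, hwj, le_trans ha₀.1 hj.le]
    exact absurd (hmax j hjs) (not_le.mpr hj)
  obtain ⟨hdet, hzero⟩ := h (b a₀) ha₀.1 ⟨a₀, rfl, ha₀.2⟩
  -- the block system at level `b a₀`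
  have hblock : (M.toSquareBlock b (b a₀) *ᵥ fun j => w j) = 0 := by
    funext ⟨a, ha⟩
    rw [← mulVec_apply_eq_of_blockTriangular hM habove a ha, hzero a ha]
    rfl
  have := congr_fun (Matrix.eq_zero_of_mulVec_eq_zero hdet hblock) ⟨a₀, rfl⟩
  exact ha₀.2 this

/-- A singular BOTTOM diagonal block of a block-triangular matrix gives a kernel vector supported
in the bottom block. [folklore] -/
theorem exists_mulVec_eq_zero_of_blockTriangular {K : Type*} [Field K] [DecidableEq ι]
    {M : Matrix ι ι K} (hM : M.BlockTriangular b) {k : α} (hk : ∀ a, k ≤ b a)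
    (hdet : (M.toSquareBlock b k).det = 0) :
    ∃ w : ι → K, w ≠ 0 ∧ (∀ a, b a ≠ k → w a = 0) ∧ M *ᵥ w = 0 := by
  classical
  obtain ⟨w₀, hw₀, hMw₀⟩ := Matrix.exists_mulVec_eq_zero_iff.mpr hdet
  refine ⟨fun a => if h : b a = k then w₀ ⟨a, h⟩ else 0, ?_, ?_, ?_⟩
  · intro hzero
    apply hw₀
    funext ⟨a, ha⟩
    have := congr_fun hzero a
    simpa [ha] using this
  · intro a ha
    simp [ha]
  · have hsupp : ∀ j, k < b j → (fun a => if h : b a = k then w₀ ⟨a, h⟩ else 0) j = 0 :=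
      fun j hj => by simp [hj.ne']
    funext a
    rcases (hk a).eq_or_lt with h | h
    · rw [mulVec_apply_eq_of_blockTriangular hM hsupp a h.symm]
      have : (fun j : {j // b j = k} =>
          (fun a => if h : b a = k then w₀ ⟨a, h⟩ else (0 : K)) j) = w₀ := by
        funext ⟨j, hj⟩
        simp [hj]
      rw [this, hMw₀]
      rfl
    · exact mulVec_apply_eq_zero_of_blockTriangular hM hsupp a h

omit [Fintype ι] [LinearOrder α] in
/-- The diagonal block of `1` is `1`. [folklore] -/
theorem toSquareBlock_one [DecidableEq ι] [Zero R] [One R] (k : α) :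
    (1 : Matrix ι ι R).toSquareBlock b k = 1 :=
  Matrix.toBlock_one_self _

omit [LinearOrder α] in
/-- A diagonal block indexed by a value not taken by the labelling has determinant `1`.
[folklore] -/
theorem det_toSquareBlock_of_not_mem [DecidableEq ι] [DecidableEq α] [CommRing R]
    (M : Matrix ι ι R) {k : α} (hk : k ∉ Finset.univ.image b) :
    (M.toSquareBlock b k).det = 1 := by
  haveI : IsEmpty {a // b a = k} :=
    ⟨fun a => hk (Finset.mem_image.mpr ⟨a, Finset.mem_univ _, a.2⟩)⟩
  exact Matrix.det_isEmpty

end Blocks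

/-! ### Bases adapted to a chain of subspaces -/

section Adapted

variable {K : Type*} [Field K] {V : Type*} [AddCommGroup V] [Module K V]

/-- Coordinates in a basis built from a set: membership in the span of a sub-family is read off
from the support of the coordinate vector. [folklore] -/
theorem mem_iff_repr_eq_zero_of_span {ι : Type*} (v : Basis ι K V) (b : ι → ℕ) (k : ℕ)
    (S : Submodule K V) (hS : S = span K (v '' {a | b a ≤ k})) (x : V) :
    x ∈ S ↔ ∀ a, k < b a → v.repr x a = 0 := by
  rw [hS, Basis.mem_span_image]
  constructor
  · intro h a ha
    by_contra hne
    have := h (Finsupp.mem_support_iff.mpr hne)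
    exact absurd this (not_le.mpr ha)
  · intro h a ha
    by_contra hle
    exact Finsupp.mem_support_iff.mp ha (h a (not_le.mp hle))

/-- **Adapted basis.**  For a chain `S₀ ≤ S₁ ≤ S₂` of subspaces of an `m`-dimensional space there
are a basis `v` indexed by `Fin m` and labels `b : Fin m → {0,1,2,3}` such that `S_k` is spanned by
the basis vectors of label `≤ k`; equivalently `x ∈ S_k` iff the coordinates of `x` at labels
`> k` vanish. [folklore] -/
theorem exists_adapted_basis [FiniteDimensional K V] {m : ℕ} (hm : Module.finrank K V = m)
    (S₀ S₁ S₂ : Submodule K V) (h₀₁ : S₀ ≤ S₁) (h₁₂ : S₁ ≤ S₂) :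
    ∃ (v : Basis (Fin m) K V) (b : Fin m → ℕ), (∀ a, b a ≤ 3) ∧
      (∀ x, x ∈ S₀ ↔ ∀ a, 0 < b a → v.repr x a = 0) ∧
      (∀ x, x ∈ S₁ ↔ ∀ a, 1 < b a → v.repr x a = 0) ∧
      (∀ x, x ∈ S₂ ↔ ∀ a, 2 < b a → v.repr x a = 0) := by
  classical
  -- nested linearly independent sets `t₀ ⊆ t₁ ⊆ t₂ ⊆ t₃` spanning `S₀, S₁, S₂, V`
  obtain ⟨t₀, ht₀S, -, hS₀t, hli₀⟩ := exists_linearIndepOn_id_extension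
    (linearIndependent_empty K V) (Set.empty_subset (S₀ : Set V))
  obtain ⟨t₁, ht₁S, ht₀₁, hS₁t, hli₁⟩ := exists_linearIndepOn_id_extension hli₀
    (ht₀S.trans (show ((S₀ : Set V) ⊆ (S₁ : Set V)) from h₀₁))
  obtain ⟨t₂, ht₂S, ht₁₂, hS₂t, hli₂⟩ := exists_linearIndepOn_id_extension hli₁
    (ht₁S.trans (show ((S₁ : Set V) ⊆ (S₂ : Set V)) from h₁₂))
  obtain ⟨t₃, -, ht₂₃, hVt, hli₃⟩ := exists_linearIndepOn_id_extension hli₂ (Set.subset_univ t₂)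
  have hli₃' : LinearIndependent K (fun x : t₃ => (x : V)) := hli₃
  have ht₃fin : t₃.Finite := hli₃'.setFinite
  letI : Fintype t₃ := ht₃fin.fintype
  have hsp : ⊤ ≤ span K (Set.range (fun x : t₃ => (x : V))) := by
    rw [Subtype.range_coe]
    exact fun x _ => hVt (Set.mem_univ x)
  let v₀ : Basis t₃ K V := Basis.mk hli₃' hsp
  have hcard : Fintype.card t₃ = m := by rw [← hm, Module.finrank_eq_card_basis v₀]
  let e : t₃ ≃ Fin m := Fintype.equivFinOfCardEq hcard
  let v : Basis (Fin m) K V := v₀.reindex e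
  have hv : ∀ a, v a = ((e.symm a : t₃) : V) := by
    intro a
    simp [v, v₀, Basis.reindex_apply, Basis.coe_mk]
  let b : Fin m → ℕ := fun a =>
    if ((e.symm a : t₃) : V) ∈ t₀ then 0 else if ((e.symm a : t₃) : V) ∈ t₁ then 1
      else if ((e.symm a : t₃) : V) ∈ t₂ then 2 else 3
  -- the image of the label-`≤ k` indices is `t_k`
  have himage : ∀ (k : ℕ) (t : Set V), t ⊆ t₃ → (∀ a, ((e.symm a : t₃) : V) ∈ t ↔ b a ≤ k) →
      v '' {a | b a ≤ k} = t := by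
    intro k t ht hiff
    ext y
    simp only [Set.mem_image, Set.mem_setOf_eq]
    constructor
    · rintro ⟨a, ha, rfl⟩
      rw [hv]
      exact (hiff a).mpr ha
    · intro hy
      refine ⟨e ⟨y, ht hy⟩, (hiff _).mp (by simpa using hy), by rw [hv]; simp⟩
  have hspan : ∀ (k : ℕ) (t : Set V) (S : Submodule K V), t ⊆ S → (S : Set V) ⊆ span K t →
      t ⊆ t₃ → (∀ a, ((e.symm a : t₃) : V) ∈ t ↔ b a ≤ k) →
      ∀ x, x ∈ S ↔ ∀ a, k < b a → v.repr x a = 0 := by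
    intro k t S htS hSt ht hiff
    apply mem_iff_repr_eq_zero_of_span v b k S
    rw [himage k t ht hiff]
    exact le_antisymm (fun x hx => hSt hx) (span_le.mpr htS)
  refine ⟨v, b, fun a => ?_, ?_, ?_, ?_⟩
  · simp only [b]; split_ifs <;> omega
  · refine hspan 0 t₀ S₀ ht₀S hS₀t (ht₀₁.trans (ht₁₂.trans ht₂₃)) fun a => ?_
    by_cases h0 : ((e.symm a : t₃) : V) ∈ t₀
    · simp [b, h0]
    · simp only [b, h0, if_false, false_iff, not_le]
      split_ifs <;> omega
  · refine hspan 1 t₁ S₁ ht₁S hS₁t (ht₁₂.trans ht₂₃) fun a => ?_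
    by_cases h0 : ((e.symm a : t₃) : V) ∈ t₀
    · have h1 : ((e.symm a : t₃) : V) ∈ t₁ := ht₀₁ h0
      simp [b, h0, h1]
    · by_cases h1 : ((e.symm a : t₃) : V) ∈ t₁
      · simp [b, h0, h1]
      · simp only [b, h0, h1, if_false, false_iff, not_le]
        split_ifs <;> omega
  · refine hspan 2 t₂ S₂ ht₂S hS₂t ht₂₃ fun a => ?_
    by_cases h0 : ((e.symm a : t₃) : V) ∈ t₀
    · have h2 : ((e.symm a : t₃) : V) ∈ t₂ := ht₁₂ (ht₀₁ h0)
      simp [b, h0, h2]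
    · by_cases h1 : ((e.symm a : t₃) : V) ∈ t₁
      · have h2 : ((e.symm a : t₃) : V) ∈ t₂ := ht₁₂ h1
        simp [b, h0, h1, h2]
      · by_cases h2 : ((e.symm a : t₃) : V) ∈ t₂
        · simp [b, h0, h1, h2]
        · simp [b, h0, h1, h2]

/-- In a basis adapted to a chain of subspaces, an endomorphism preserving every member of the
chain has a block (upper) triangular matrix.  Here the chain is presented by the coordinate
description `x ∈ S_k ↔ (coordinates of label > k vanish)` for every `k`. [folklore] -/
theorem blockTriangular_toMatrix_of_adapted {ι : Type*} [Fintype ι] [DecidableEq ι]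
    (v : Basis ι K V) (b : ι → ℕ) (chain : ℕ → Submodule K V)
    (hchain : ∀ k x, x ∈ chain k ↔ ∀ a, k < b a → v.repr x a = 0)
    (f : V →ₗ[K] V) (hf : ∀ k, ∀ x ∈ chain k, f x ∈ chain k) :
    (LinearMap.toMatrix v v f).BlockTriangular b := by
  intro i j hij
  rw [LinearMap.toMatrix_apply]
  have hvj : v j ∈ chain (b j) := by
    rw [hchain]
    intro a ha
    rw [v.repr_self, Finsupp.single_apply, if_neg]
    rintro rfl
    exact lt_irrefl _ ha
  exact (hchain (b j) (f (v j))).mp (hf _ _ hvj) i hij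

end Adapted

/-! ### Kernel transfer along a block-triangular endomorphism -/

section Transfer

variable {K : Type*} [Field K] {V : Type*} [AddCommGroup V] [Module K V]
  {ι : Type*} [Fintype ι] [DecidableEq ι]

/-- If the diagonal blocks of levels `≤ k₁` of (the matrix of) `N` are nonsingular, `N` is
injective on the subspace of vectors living at levels `≤ k₁`. [folklore] -/
theorem injOn_of_det_toSquareBlock_ne_zero (v : Basis ι K V) (b : ι → ℕ) (N : V →ₗ[K] V)
    (hN : (LinearMap.toMatrix v v N).BlockTriangular b) (S : Submodule K V) (k₁ : ℕ)
    (hS : ∀ x, x ∈ S ↔ ∀ a, k₁ < b a → v.repr x a = 0)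
    (hdet : ∀ k, k ≤ k₁ → ((LinearMap.toMatrix v v N).toSquareBlock b k).det ≠ 0) :
    ∀ x ∈ S, N x = 0 → x = 0 := by
  intro x hx hNx
  have hw : ∀ a, k₁ < b a → (v.repr x : ι → K) a = 0 := (hS x).mp hx
  have hMw : LinearMap.toMatrix v v N *ᵥ (v.repr x : ι → K) = 0 := by
    rw [LinearMap.toMatrix_mulVec_repr, hNx, map_zero]
    rfl
  have hall : ∀ a, (v.repr x : ι → K) a = 0 := by
    intro a₀
    refine eq_zero_of_blockTriangular_mulVec hN (v.repr x : ι → K) (b a₀) ?_ a₀ le_rfl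
    intro k _ hk
    refine ⟨hdet k ?_, fun a _ => by rw [hMw]; rfl⟩
    by_contra hlt
    obtain ⟨a, rfl, ha⟩ := hk
    exact ha (hw a (not_le.mp hlt))
  have : v.repr x = 0 := Finsupp.ext hall
  exact (LinearEquiv.map_eq_zero_iff v.repr).mp this

/-- If the diagonal blocks of levels `> k₁` of `N` are nonsingular, `N x` at levels `≤ k₁` forces
`x` at levels `≤ k₁` (injectivity of `N` on the quotient). [folklore] -/
theorem mem_of_apply_mem_of_det_toSquareBlock_ne_zero (v : Basis ι K V) (b : ι → ℕ)
    (N : V →ₗ[K] V) (hN : (LinearMap.toMatrix v v N).BlockTriangular b) (S : Submodule K V)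
    (k₁ : ℕ) (hS : ∀ x, x ∈ S ↔ ∀ a, k₁ < b a → v.repr x a = 0)
    (hdet : ∀ k, k₁ < k → ((LinearMap.toMatrix v v N).toSquareBlock b k).det ≠ 0) :
    ∀ x, N x ∈ S → x ∈ S := by
  intro x hNx
  have hMw : ∀ a, k₁ < b a → (LinearMap.toMatrix v v N *ᵥ (v.repr x : ι → K)) a = 0 := by
    rw [LinearMap.toMatrix_mulVec_repr]
    exact (hS (N x)).mp hNx
  rw [hS]
  intro a ha
  refine eq_zero_of_blockTriangular_mulVec hN (v.repr x : ι → K) (k₁ + 1) ?_ a ha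
  intro k hk _
  exact ⟨hdet k hk, fun a' ha' => hMw a' (by omega)⟩

/-- A singular bottom block of `N` produces a non-zero kernel vector in the bottom subspace.
[folklore] -/
theorem exists_mem_ker_of_det_toSquareBlock_eq_zero (v : Basis ι K V) (b : ι → ℕ)
    (N : V →ₗ[K] V) (hN : (LinearMap.toMatrix v v N).BlockTriangular b) (S : Submodule K V)
    (k : ℕ) (hk : ∀ a, k ≤ b a) (hS : ∀ x, x ∈ S ↔ ∀ a, k < b a → v.repr x a = 0)
    (hdet : ((LinearMap.toMatrix v v N).toSquareBlock b k).det = 0) :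
    ∃ x ∈ S, x ≠ 0 ∧ N x = 0 := by
  obtain ⟨w, hw0, hwsupp, hMw⟩ := exists_mulVec_eq_zero_of_blockTriangular hN hk hdet
  refine ⟨v.equivFun.symm w, ?_, ?_, ?_⟩
  · rw [hS]
    intro a ha
    have : (v.repr (v.equivFun.symm w) : ι → K) = w := by
      funext a
      rw [← Basis.equivFun_apply, LinearEquiv.apply_symm_apply]
    rw [this]
    exact hwsupp a (by omega)
  · intro h
    apply hw0
    have := congrArg v.equivFun h
    rwa [LinearEquiv.apply_symm_apply, map_zero] at this
  · have hrepr : (v.repr (N (v.equivFun.symm w)) : ι → K) = 0 := by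
      rw [← LinearMap.toMatrix_mulVec_repr v v N]
      have : (v.repr (v.equivFun.symm w) : ι → K) = w := by
        funext a
        rw [← Basis.equivFun_apply, LinearEquiv.apply_symm_apply]
      rw [this, hMw]
    have : v.repr (N (v.equivFun.symm w)) = 0 := Finsupp.ext fun a => congr_fun hrepr a
    exact (LinearEquiv.map_eq_zero_iff v.repr).mp this

end Transfer

end Summit.ValiantsHypothesis.ValiantsHypothesis.Theorems.SymPencilEquivariantSdcNotQP.FiniteLift

end
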